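import Summits.CriticalPhenomena.Ising3D.Control2DTaylorSound
import Summits.CriticalPhenomena.Ising3D.Control2DOpeConvergenceFree
import Mathlib.Tactic.Linarith
import Mathlib.Tactic.Positivity
import HarnessLib

/-!
# Derivative functionals act termwise on the sum rule of EVERY unitary solution at `Δ_σ > 0` — the `_taylor` soundness
# theorems without their `2Δ_σ` clauses
(cell `pub-ising3x`, seat controls-1 gen 44; KERNEL PATH of the 2D derivative-functional certificates — CONTROL-ONLY; sequel to
`Control2DTaylorTermwise` / `Control2DTaylorSound` (gen 14) and `Control2DOpeConvergenceFree` (gen 43))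

HONEST FRAMING: lottery ticket; floor = tightest certified 3D Ising CFT bounds; no exact-solution
claim without a proof. CONTROL-ONLY (`d = 2`, axiom set `A2D′`); nothing numerical is asserted here, no certificate,
functional or number of the record is touched, and no new hypothesis or named fact enters.

WHAT THIS FILE ADDS. A Taylor (derivative) functional `φ` at a diagonal point `(x,x)` acts termwise on the typed sum rule
`Σ p_i F_-[g_i] = -F_-[1]` only under an M-test, which `Control2DTaylorTermwise.hasSum_taylor_family` reduced to absolute
convergence of the diagonal expansion `Σ p_i g_i(y,y)` at every `y ∈ (0,1)`. Gen 14 derived that convergence inside each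
statement's contradiction branch from a LOWER BOUND on the exchanged dimensions (`U > 2Δ_σ`, `e₁ > 2Δ_σ`, `G > 2Δ_σ`, `Δ_σ < 1`),
so every `_taylor` soundness theorem of `Control2DTaylorSound` carries such clauses. Gen 43's `opeConvergent_free` gives the
convergence for EVERY unitary solution at `Δ_σ > 0`, hence:

* **`CrossingData.hasSum_taylor_free`** — `IsTaylorFunctional x x φ`, `0 < x < 1`, `IsUnitary`, `SatisfiesCrossing s`, `0 < s`
  ⇒ `HasSum (fun i => p_i · φ(F_-[g_i])) (-φ(F_-[1]))`: every derivative functional at a diagonal point of the square acts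
  termwise on the sum rule of every unitary typed solution — no gap, box, location or `Δ_σ < 1` clause.
* The `_taylor_free` twins of the ten gen-14 soundness theorems, with «`e₁ > 2Δ_σ`, `G > 2Δ_σ`, `U > 2Δ_σ`, `gap > 2Δ_σ`,
  `Δ_σ < 1`» replaced by «`0 < Δ_σ`» (resp. `0 < σ₁` for the D-box kinds): `GapObligations.gapExcluded_taylor_free`,
  `OpeObligations.opeBound_taylor_free`, `BoxObligations.boxExcluded_taylor_free / excludedOn_taylor_free /
  rectExcluded_taylor_free / excludedOn₂_taylor_free`, `OpeA2DObligations.opeUpper_taylor_free / opeLower_taylor_free`,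
  `OpeEpsA2DObligations.opeEpsUpper_taylor_free / opeEpsLower_taylor_free`.

For the record (`Δ_σ = 1/8`, `e₁ ≈ 0.98`, `G = 2`, `U ≈ 1`) the old clauses held anyway: this is index-tidying of the kernel
path, not a new bound — the soundness of the derivative-functional certificate kinds no longer refers to where the `A2D′`
numbers sit relative to `2Δ_σ`. The gen-14 theorems are kept (they also cover `Δ_σ ≤ 0`, where the typed class is degenerate).

NOT claimed: anything at `Δ_σ ≤ 0`; anything numerical; any certificate obligation discharged; anything three-dimensional.

References: R. Rattazzi, V. S. Rychkov, E. Tonni, A. Vichi, JHEP 12 (2008) 031, §5 (the linear-functional argument)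
[cite: RattazziEtAl2008, §5]; A. de la Fuente, arXiv:1904.09801, §2 (`A2D′`). Tree: `hasSum_taylor_family`
(`Control2DTaylorTermwise`); `opeConvergent_free` (`Control2DOpeConvergenceFree`); `BoxObligations.false_of_hasSum`,
`GapObligations`, `OpeObligations`, `OpeA2DObligations`, `OpeEpsA2DObligations` and the gen-14 `_taylor` proofs
(`Control2DTaylorSound`, `Control2DOpeTwoSided`, `Control2DOpeEpsTwoSided`), followed here verbatim with the free termwise
identity substituted.
-/

namespace Summit.CriticalPhenomena.Ising3D.Control2D

open Set
open Literature.MathematicalPhysics.QuantumFieldTheory.ConformalBootstrap3D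

namespace CrossingData

variable {D : CrossingData} {s x : ℝ} {φ : (ℝ → ℝ → ℝ) →ₗ[ℝ] ℝ}

/-- **Termwise action of a derivative functional, hypothesis-free at `Δ_σ > 0`.** For every unitary solution of the typed
`⟨σσσσ⟩` sum rule at `Δ_σ = s > 0` and every Taylor functional `φ` at a diagonal point `(x,x)`, `0 < x < 1`:
`Σ_i p_i φ(F_-[g_i]) = -φ(F_-[1])` as a `HasSum` — `hasSum_taylor_family` with its diagonal-convergence input discharged by
`opeConvergent_free`. [cite: RattazziEtAl2008, §5] -/
theorem hasSum_taylor_free (hφ : IsTaylorFunctional x x φ) (hx0 : 0 < x) (hx1 : x < 1) (hU : D.IsUnitary)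
    (hC : D.SatisfiesCrossing s) (hs : 0 < s) :
    HasSum (fun i => D.p i * φ (crossF s (-1) (globalBlock (D.Δ i) (D.spin i))))
      (-(φ (crossF s (-1) (fun _ _ => (1 : ℝ))))) :=
  hasSum_taylor_family hφ hx0 hx1 (fun i => (hU i).2.1) (fun i => (hU i).2.2) hC
    (fun y hy => opeConvergent_free hU hC hs y y hy hy)

end CrossingData

/-! ### Gap and OPE certificates (`Control2DBootstrap`) -/

namespace GapObligations

variable {φ : (ℝ → ℝ → ℝ) →ₗ[ℝ] ℝ} {s U E₀ x : ℝ}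

/-- **Soundness of a gap certificate by a Taylor functional, at `Δ_σ > 0`, no clause on `U`.** A Taylor functional at a
diagonal point `(x,x)`, `0 < x < 1`, satisfying the gap obligations excludes the gap `U` whenever `Δ_σ > 0` (compare
`gapExcluded_taylor`: `U > 2Δ_σ`, `Δ_σ < 1`). [cite: RattazziEtAl2008, §5] -/
theorem gapExcluded_taylor_free (hφ : IsTaylorFunctional x x φ) (hx0 : 0 < x) (hx1 : x < 1) (hs : 0 < s)
    (h : GapObligations φ s U E₀) : GapExcluded s U := by
  intro D hU hC hgap
  have hsum := CrossingData.hasSum_taylor_free hφ hx0 hx1 hU hC hs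
  have hnn : ∀ i, 0 ≤ D.p i * φ (crossF s (-1) (globalBlock (D.Δ i) (D.spin i))) := fun i =>
    mul_nonneg (hU i).2.2
      (h.blockPositive (D.spin i) (hU i).1 (D.Δ i) (hU i).2.1 (fun h0 => hgap i h0))
  have h0 : (0 : ℝ) ≤ -(φ (crossF s (-1) (fun _ _ => (1 : ℝ)))) := hsum.nonneg hnn
  linarith [h.identity_pos]

end GapObligations

namespace OpeObligations

variable {φ : (ℝ → ℝ → ℝ) →ₗ[ℝ] ℝ} {s gap P E₀ x : ℝ}

/-- **Soundness of an OPE certificate by a Taylor functional, at `Δ_σ > 0`, no clause on the gap** (compare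
`opeBound_taylor`: `gap > 2Δ_σ`, `Δ_σ < 1`): termwise, `p_T φ[F_T] ≤ Σ p φ[F] = -φ[F_1] < P φ[F_T]`.
[cite: RattazziEtAl2008, §5] -/
theorem opeBound_taylor_free (hφ : IsTaylorFunctional x x φ) (hx0 : 0 < x) (hx1 : x < 1) (hs : 0 < s)
    (h : OpeObligations φ s gap P E₀) : OpeBound s gap P := by
  intro D hU hC hgap i hΔ hspin
  have hsum := CrossingData.hasSum_taylor_free hφ hx0 hx1 hU hC hs
  have hnn : ∀ j, 0 ≤ D.p j * φ (crossF s (-1) (globalBlock (D.Δ j) (D.spin j))) := fun j =>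
    mul_nonneg (hU j).2.2
      (h.blockPositive (D.spin j) (hU j).1 (D.Δ j) (hU j).2.1 (fun h0 => hgap j h0))
  have hle : D.p i * φ (crossF s (-1) (globalBlock (D.Δ i) (D.spin i)))
      ≤ -(φ (crossF s (-1) (fun _ _ => (1 : ℝ)))) := le_hasSum hsum i (fun j _ => hnn j)
  rw [hΔ, hspin] at hle
  have hT := h.stress_pos
  have hI := h.identity_ope
  by_contra hnot
  have hPle : P ≤ D.p i := not_lt.mp hnot
  have : P * φ (crossF s (-1) (globalBlock 2 2)) ≤
      D.p i * φ (crossF s (-1) (globalBlock 2 ((2 : ℕ)))) :=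
    mul_le_mul_of_nonneg_right hPle hT.le
  linarith

end OpeObligations

/-! ### Kind `box` (`FORMAT deriv-functional-2d/2` and `/3`) -/

namespace BoxObligations

variable {φ : (ℝ → ℝ → ℝ) →ₗ[ℝ] ℝ} {s G δ e₁ e₂ E₀ x : ℝ}

/-- **Soundness of kind `box` for a Taylor functional, at `Δ_σ > 0`, ANY box** (compare `boxExcluded_taylor`: `e₁ > 2Δ_σ`,
`G > 2Δ_σ`, `Δ_σ < 1`): a Taylor functional at `(x,x)` satisfying the box obligations gives `BoxExcluded s G δ e₁ e₂`.
[cite: RattazziEtAl2008, §5] -/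
theorem boxExcluded_taylor_free (hφ : IsTaylorFunctional x x φ) (hx0 : 0 < x) (hx1 : x < 1) (hs : 0 < s)
    (h : BoxObligations φ s G δ e₁ e₂ E₀) : BoxExcluded s G δ e₁ e₂ := by
  intro D hU hC hS hT2
  exact h.false_of_hasSum hU hS hT2 (CrossingData.hasSum_taylor_free hφ hx0 hx1 hU hC hs)

/-- **Kind `box`, location-wise, at `Δ_σ > 0`, no clause on `G`** (compare `excludedOn_taylor`: `G > 2Δ_σ`, `Δ_σ < 1`):
`ExcludedOn s G δ (Icc e₁ e₂)`, the input of `twoSided_of_cover`. [cite: RattazziEtAl2008, §5] -/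
theorem excludedOn_taylor_free (hφ : IsTaylorFunctional x x φ) (hx0 : 0 < x) (hx1 : x < 1) (hs : 0 < s)
    (h : BoxObligations φ s G δ e₁ e₂ E₀) : ExcludedOn s G δ (Icc e₁ e₂) :=
  (h.boxExcluded_taylor_free hφ hx0 hx1 hs).excludedOn

/-- **D-box (`FORMAT /3`) for a Taylor functional, at `σ₁ > 0`** (compare `rectExcluded_taylor`: `e₁ > 2σ₂`, `G > 2σ₂`,
`σ₂ < 1`): one Taylor functional satisfying the box obligations at every `s ∈ [σ₁, σ₂]` gives `RectExcluded G δ σ₁ σ₂ e₁ e₂`.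
[cite: RattazziEtAl2008, §5] -/
theorem rectExcluded_taylor_free {σ₁ σ₂ : ℝ} (hφ : IsTaylorFunctional x x φ) (hx0 : 0 < x) (hx1 : x < 1)
    (hσ : 0 < σ₁) (h : ∀ s ∈ Icc σ₁ σ₂, BoxObligations φ s G δ e₁ e₂ E₀) : RectExcluded G δ σ₁ σ₂ e₁ e₂ :=
  fun s hs => (h s hs).boxExcluded_taylor_free hφ hx0 hx1 (lt_of_lt_of_le hσ hs.1)

/-- **D-box, location-wise, at `σ₁ > 0`** (compare `excludedOn₂_taylor`: `G > 2σ₂`, `σ₂ < 1`): the pointwise exclusion of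
every pair of the rectangle, `ExcludedOn₂ G δ ([σ₁,σ₂] × [e₁,e₂])` — the input of the strip / island cover assembly.
[cite: RattazziEtAl2008, §5] -/
theorem excludedOn₂_taylor_free {σ₁ σ₂ : ℝ} (hφ : IsTaylorFunctional x x φ) (hx0 : 0 < x) (hx1 : x < 1)
    (hσ : 0 < σ₁) (h : ∀ s ∈ Icc σ₁ σ₂, BoxObligations φ s G δ e₁ e₂ E₀) :
    ExcludedOn₂ G δ (Icc σ₁ σ₂ ×ˢ Icc e₁ e₂) := by
  rintro ⟨s, x₀⟩ ⟨hs, hx₀⟩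
  exact (h s hs).excludedOn_taylor_free hφ hx0 hx1 (lt_of_lt_of_le hσ hs.1) x₀ hx₀

end BoxObligations

/-! ### Kind `ope2` (`Control2DOpeTwoSided`) -/

namespace OpeA2DObligations

variable {φ : (ℝ → ℝ → ℝ) →ₗ[ℝ] ℝ} {s G δ e₁ e₂ P E₀ x : ℝ}

/-- **Soundness of kind `ope2`, sense upper, for a Taylor functional, at `Δ_σ > 0`** (compare `opeUpper_taylor`:
`e₁ > 2Δ_σ`, `G > 2Δ_σ`, `Δ_σ < 1`). [cite: RattazziEtAl2008, §5] -/
theorem opeUpper_taylor_free (hφ : IsTaylorFunctional x x φ) (hx0 : 0 < x) (hx1 : x < 1) (hs : 0 < s)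
    (h : OpeA2DObligations φ s G δ e₁ e₂ P E₀) (hX : 0 < φ (crossF s (-1) (globalBlock 2 2))) :
    OpeUpperA2D s G δ e₁ e₂ P := by
  intro D hU hC hS hT2
  unfold CrossingData.stressCoeff
  refine indicator_tsum_lt_of_hasSum D.stressSet (CrossingData.hasSum_taylor_free hφ hx0 hx1 hU hC hs)
    (fun i => (hU i).2.2) (fun i hi => ?_) (fun i hi => h.blockPositive_off_T hU hS hT2 i hi) h.identity_ope hX
  obtain ⟨hΔ, hℓ⟩ := hi
  rw [hΔ, hℓ]

/-- **Soundness of kind `ope2`, sense lower, for a Taylor functional, at `Δ_σ > 0`** (compare `opeLower_taylor`).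
[cite: RattazziEtAl2008, §5] -/
theorem opeLower_taylor_free (hφ : IsTaylorFunctional x x φ) (hx0 : 0 < x) (hx1 : x < 1) (hs : 0 < s)
    (h : OpeA2DObligations φ s G δ e₁ e₂ P E₀) (hX : φ (crossF s (-1) (globalBlock 2 2)) < 0) :
    OpeLowerA2D s G δ e₁ e₂ P := by
  intro D hU hC hS hT2
  unfold CrossingData.stressCoeff
  refine lt_indicator_tsum_of_hasSum D.stressSet (CrossingData.hasSum_taylor_free hφ hx0 hx1 hU hC hs)
    (fun i => (hU i).2.2) (fun i hi => ?_) (fun i hi => h.blockPositive_off_T hU hS hT2 i hi) h.identity_ope hX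
  obtain ⟨hΔ, hℓ⟩ := hi
  rw [hΔ, hℓ]

end OpeA2DObligations

/-! ### Kind `ope2eps` (`Control2DOpeEpsTwoSided`) -/

namespace OpeEpsA2DObligations

variable {φ : (ℝ → ℝ → ℝ) →ₗ[ℝ] ℝ} {s G δ e₁ e₂ P E₀ x : ℝ}

/-- **Soundness of kind `ope2eps`, sense upper, for a Taylor functional, at `Δ_σ > 0`** (compare `opeEpsUpper_taylor`:
`e₁ > 2Δ_σ`, `G > 2Δ_σ`, `Δ_σ < 1`): the obligations plus `φ[F_-[g_{Δ,0}]] > 0` on the box and `P > 0` give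
`OpeEpsUpperA2D`. [cite: RattazziEtAl2008, §5] -/
theorem opeEpsUpper_taylor_free (hφ : IsTaylorFunctional x x φ) (hx0 : 0 < x) (hx1 : x < 1) (hs : 0 < s)
    (h : OpeEpsA2DObligations φ s G δ e₁ e₂ P E₀) (hP : 0 < P)
    (hX : ∀ Δ : ℝ, e₁ ≤ Δ → Δ ≤ e₂ → 0 < φ (crossF s (-1) (globalBlock Δ 0))) :
    OpeEpsUpperA2D s G δ e₁ e₂ P := by
  intro D hU hC hS hT2
  unfold CrossingData.boxWeight
  refine (box_tsum_lt_of_hasSum (D.boxSet e₁ e₂) (c := fun i => (2 : ℝ) ^ (-D.Δ i))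
    (CrossingData.hasSum_taylor_free hφ hx0 hx1 hU hC hs) (fun i => (hU i).2.2)
    (fun i _ => Real.rpow_pos_of_pos (by norm_num) _)
    (fun i hi => h.blockPositive_off_box hU hS hT2 i hi) (fun i hi => ?_) (fun i hi => ?_) hP).2
  · obtain ⟨h0, hΔ⟩ := hi
    have := hX (D.Δ i) hΔ.1 hΔ.2
    rwa [h0]
  · obtain ⟨h0, hΔ⟩ := hi
    have := h.identity_ope (D.Δ i) hΔ.1 hΔ.2
    rwa [h0, div_two_rpow_neg]

/-- **Soundness of kind `ope2eps`, sense lower, for a Taylor functional, at `Δ_σ > 0`** (compare `opeEpsLower_taylor`):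
the obligations plus a uniform negative sign margin `2^Δ φ[F_-[g_{Δ,0}]] ≤ -σ < 0` on the box, a non-empty box and `P > 0` give
`OpeEpsLowerA2D`. [cite: RattazziEtAl2008, §5] -/
theorem opeEpsLower_taylor_free (hφ : IsTaylorFunctional x x φ) (hx0 : 0 < x) (hx1 : x < 1) (hs : 0 < s)
    (h : OpeEpsA2DObligations φ s G δ e₁ e₂ P E₀) (hP : 0 < P) (he₁₂ : e₁ ≤ e₂) {σ : ℝ} (hσ : 0 < σ)
    (hX : ∀ Δ : ℝ, e₁ ≤ Δ → Δ ≤ e₂ → (2 : ℝ) ^ Δ * φ (crossF s (-1) (globalBlock Δ 0)) ≤ -σ) :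
    OpeEpsLowerA2D s G δ e₁ e₂ P := by
  intro D hU hC hS hT2
  unfold CrossingData.boxWeight
  have ha₁ : 0 < φ (crossF s (-1) (fun _ _ => (1 : ℝ))) := by
    have h1 := h.identity_ope e₁ le_rfl he₁₂
    have h2 := hX e₁ le_rfl he₁₂
    nlinarith
  refine (lt_box_tsum_of_hasSum (D.boxSet e₁ e₂) (c := fun i => (2 : ℝ) ^ (-D.Δ i))
    (CrossingData.hasSum_taylor_free hφ hx0 hx1 hU hC hs) (fun i => (hU i).2.2)
    (fun i _ => Real.rpow_pos_of_pos (by norm_num) _)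
    (fun i hi => h.blockPositive_off_box hU hS hT2 i hi) hσ (fun i hi => ?_) (fun i hi => ?_) ha₁ hP).2
  · obtain ⟨h0, hΔ⟩ := hi
    have := hX (D.Δ i) hΔ.1 hΔ.2
    rwa [h0, div_two_rpow_neg]
  · obtain ⟨h0, hΔ⟩ := hi
    have := h.identity_ope (D.Δ i) hΔ.1 hΔ.2
    rwa [h0, div_two_rpow_neg]

end OpeEpsA2DObligations

/-! ### At `Δ_σ = 1/8` -/

/-- **At `Δ_σ = 1/8`**: a Taylor functional at any diagonal point of the square satisfying the gap obligations excludes its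
gap `U` — whatever `U` is (the gen-14 twin needed `U > 1/4`). CONTROL-ONLY; no certificate obligation is discharged here.
[cite: RattazziEtAl2008, §5] -/
theorem gapExcluded_taylor_eighth {φ : (ℝ → ℝ → ℝ) →ₗ[ℝ] ℝ} {U E₀ x : ℝ} (hφ : IsTaylorFunctional x x φ)
    (hx0 : 0 < x) (hx1 : x < 1) (h : GapObligations φ (1 / 8) U E₀) : GapExcluded (1 / 8) U :=
  h.gapExcluded_taylor_free hφ hx0 hx1 (by norm_num)

end Summit.CriticalPhenomena.Ising3D.Control2D
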